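import Literature.NumberTheory.PAdicHodge.AinfRamifiedDivisionTransportTateModule
import Literature.NumberTheory.PAdicHodge.BmaxPlusPhiRoadKummer
import HarnessLib

/-!
# The TRANSPORTED `A_max`-period map on `T_pŴ_D(𝒪_{ℂ_F})` for a ramified good model `W_D ≡ E₀ (mod ϖ)`: additivity, `ℤ_p`-linearity,
# `Γ_F`-equivariance, the honest map `LT : T_pŴ_D →+ A_max`, the Honda relation and the Kummer integrating identity

Topic `Literature/NumberTheory/PAdicHodge` (theorems only; no definition, no named fact, no instance, no `sorry`). Sequel of
`AinfRamifiedDivisionTransportTateModule` (the CM-fibre transport `T` on `T_pŴ_D = TatePtO F (W.map ψ) p`: unique exact `[p]_{E₀}`-towers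
`ϖ`-close to the coordinate sequences, additive for `⊕_{W_D}`, `Γ_F`-equivariant, of depth `‖T(τ)₀‖^N ≤ ‖p‖` for `N ≥ e`) and of the φ-road's
tower instantiation (`BmaxPlusFormalLogDivisionTower`, `BmaxPlusFormalLogPeriodMap`, `BmaxPlusTatePeriodHom`: the `A_max`-periods
`Λ_N(ι[ũ], z) = p^N·log_{E₀}(ι[ũ])` of ANY `[p]_{E₀}`-division sequence `u` of `Ê₀(𝔪_{ℂ_F})`, additive on deep towers, `Γ_F`-equivariant, with the
EXACT Dieudonné–Honda relation). Here the two are composed: the **transported period** of `τ ∈ T_pŴ_D` is `Λ^T_τ := Λ_N(ι[T(τ)~], z)`, the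
`A_max`-period of Fontaine's integral of the transported tower (`E₀/ℤ`, so the unramified ring `𝔸_inf` suffices although `W_D` lives over the
ramified `𝒪_D = ℤ_p[ϖ]`).

* §1 ★ `logSum_transport_add` — **ADDITIVITY `Λ^T_{τ+τ'} = Λ^T_τ + Λ^T_{τ'}`** (any transports, any witnesses; `T(τ + τ') = T(τ) ⊕_{E₀} T(τ')` and
  `logSum_divisionLiftPt_addSeq` at depth `N ≥ e`); ★ `galBmaxPlus_logSum_transport` — **`Γ_F`-EQUIVARIANCE `σ(Λ^T_τ) = Λ^T_{σ•τ}`**.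
* §2 ★★ `exists_addMonoidHom_logSum_transport` — the transported period map as an HONEST additive map **`LT : T_pŴ_D →+ A_max`** with
  `LT τ = Λ_N(ι[T(τ)~], z)` for EVERY transport and EVERY witness, **`ℤ_p`-linear** (`LT (c • τ) = ι(c)·LT τ`, density of `ℕ` in `ℤ_p` + `p`-adic
  separatedness of `A_max`) and **`Γ_F`-equivariant**.
* §3 ★ `frobBmaxPlus_hondaTrace_transport_eq_zero` — the EXACT Honda relation **`φ²(LT τ) − a_p(E₀)·φ(LT τ) + p·LT τ = 0`** (the φ-road's
  `frobBmaxPlus_hondaTrace_logSum_divisionLiftPt_eq_zero` on the transported tower; `E₀ ⊗ ℚ_p`, `E₀ ⊗ 𝔽_p` elliptic).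
* §4 ★★ `logSum_transport_kummerCocycleO` — the **Kummer integrating identity**: for a `[p]_{W_D}`-division tower `u` of a `Γ_F`-fixed point with
  transport `Tu` (`‖(Tu)₀‖^N ≤ ‖p‖`) and period `Λ_{Tu} = Λ_N(ι[Tu~], z)`, the Kummer cocycle `κ_u(σ) ∈ T_pŴ_D` (`AinfRamTop.kummerCocycleO`) has
  **`LT(κ_u σ) = σ(Λ_{Tu}) − Λ_{Tu}`** (`T(κ_u σ) ⊕_{E₀} Tu = σ·Tu`, `addSeq_transport_kummer_eq_galSeq`).

This is T2 («transported periods on `T_pŴ_D`, in the φ-road's API») of memo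
`Summits/BirchSwinnertonDyer/BirchSwinnertonDyer/Cruxes/StarredOptimalManinUnitFiveSeven/Lines/kato-lever-K2-ramified-cm-transport.md` §8–§9 (line
`kato_lever`, crux K★ `stmt-BirchSwinnertonDyer-22226`): composed with `φ` and `bmaxPlusToBdR` it gives the honest maps `P⁰ = f∘LT`, `Q⁰ = f∘φ∘LT`
whose Hodge combination `A·P⁰ + B·Q⁰` (`TransportedHodgeLine`) is the cells' `Pω″`. Infrastructure only: BSD / K★ are NOT proved by any of this;
nothing about elliptic curves over number fields is proved here.

## References
* P. Colmez, *Périodes p-adiques des variétés abéliennes*, Math. Ann. 292 (1992), §2. [Colmez1992PeriodesAbeliennes]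
* N. M. Katz, *Crystalline cohomology, Dieudonné modules, and Jacobi sums* (1981), Thm. 5.1.4–5.1.5. [Katz1981CrystallineDieudonne]
* J.-M. Fontaine, *Le corps des périodes p-adiques*, Astérisque 223 (1994), Exp. II §1.2.2, §1.5. [FontaineAsterisque223III]
* T. Honda, *On the theory of commutative formal groups*, J. Math. Soc. Japan 22 (1970), Thm. 2. [Honda1970]
* S. Bloch, K. Kato, *L-functions and Tamagawa numbers of motives* (1990), Ex. 3.10.1. [BlochKato1990]
-/

noncomputable section

open Ideal WittVector ValuativeRel Field
open scoped Classical

namespace Literature.NumberTheory.PAdicHodge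

open Literature.NumberTheory.GaloisRepresentations Literature.NumberTheory.GaloisRepresentations.IsNonarchimedeanLocalField
open Literature.NumberTheory.GaloisRepresentations.LubinTate Literature.NumberTheory.EllipticCurves
open Literature.RingTheory.FormalGroups

variable {F : Type} [Field F] [ValuativeRel F] [TopologicalSpace F] [IsNonarchimedeanLocalField F] [CharZero F]
  {p : ℕ} [hpp : Fact p.Prime] [Fact (¬ IsUnit (p : integerC F))] [IsAdicComplete (Ideal.span {(p : integerC F)}) (integerC F)]
  {hp : valuation F p < 1} (D : EisensteinRoot F p hp) {hθ : Function.Surjective (fontaineTheta (integerC F) p)}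
  (W : WeierstrassCurve (EisensteinRoot.CoeffDisc D)) (E₀ : WeierstrassCurve ℤ)
  (hWE : W.map (Ideal.Quotient.mk (Ideal.span {EisensteinRoot.CoeffDisc.of D (AdjoinRoot.root D.poly)})) =
    (E₀.map (algebraMap ℤ (EisensteinRoot.CoeffDisc D))).map
      (Ideal.Quotient.mk (Ideal.span {EisensteinRoot.CoeffDisc.of D (AdjoinRoot.root D.poly)})))
  (ψ : EisensteinRoot.CoeffDisc D →+* LTCoeff F) (hψ : ∀ c, algebraMap (LTCoeff F) F (ψ c) = EisensteinRoot.CoeffDisc.toF D c)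

/-! ## §0 Witnesses for transported towers -/

/-- **Index-`N` nilpotence of Fontaine's integral of a transported tower**: `(ι[T(τ)~])^N ∈ (p, ξ)` for `N ≥ e` (depth `‖T(τ)₀‖^N ≤ ‖p‖`,
`AinfDivisionTowerNilpotence.pow_coe_val_nsmul_divisionLiftPt_mem`). [cite: FontaineAsterisque223III, Exp. II §1.3] [cite: Colmez1992PeriodesAbeliennes, §2] -/
theorem pow_coe_val_divisionLiftPt_transport_mem (τ : AinfTop.TatePtO F (W.map ψ) p) {w : ℕ → (maxNilIdealC F).toIdeal}
    (hw : ∀ n, AinfTop.mulPC F p E₀ (w (n + 1)) = w n)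
    (hwv : ∀ n, ‖(((w n : (maxNilIdealC F).toIdeal) : CBall F) : CompletedAlgClosure F) -
      (((AinfTop.seqO (W.map ψ) τ n : (maxNilIdealC F).toIdeal) : CBall F) : CompletedAlgClosure F)‖ ≤ ‖((D.rootC : integerC F) : CompletedAlgClosure F)‖) {N : ℕ} (hN : D.e ≤ N) :
    (((AinfTop.divisionLiftPt E₀ hθ w hw).val : (AinfTop.nilTheta F p hθ).toIdeal) : AinfTop F p) ^ N ∈ (WithIdeal.i : Ideal (AinfTop F p)) := by
  simpa only [one_nsmul] using
    AinfTop.pow_coe_val_nsmul_divisionLiftPt_mem E₀ (hθ := hθ) hw (norm_transport_seqO_zero_pow_le D W ψ τ hwv hN) 1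

/-- **Witnesses exist**: `ι[T(τ)~]^N = p·z` for some `z ∈ B⁰_max` (`N ≥ e`). [cite: FontaineAsterisque223III, Exp. II §1.3] -/
theorem exists_witness_transport (τ : AinfTop.TatePtO F (W.map ψ) p) {w : ℕ → (maxNilIdealC F).toIdeal}
    (hw : ∀ n, AinfTop.mulPC F p E₀ (w (n + 1)) = w n)
    (hwv : ∀ n, ‖(((w n : (maxNilIdealC F).toIdeal) : CBall F) : CompletedAlgClosure F) -
      (((AinfTop.seqO (W.map ψ) τ n : (maxNilIdealC F).toIdeal) : CBall F) : CompletedAlgClosure F)‖ ≤ ‖((D.rootC : integerC F) : CompletedAlgClosure F)‖) {N : ℕ} (hN : D.e ≤ N) :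
    ∃ z : bmaxZero F p, algebraMap (Ainf (p := p) F) (bmaxZero F p)
        ((AinfTop.of F p).symm (((AinfTop.divisionLiftPt E₀ hθ w hw).val : (AinfTop.nilTheta F p hθ).toIdeal) : AinfTop F p)) ^ N =
      (p : bmaxZero F p) * z :=
  exists_algebraMap_pow_eq_natCast_mul (pow_coe_val_divisionLiftPt_transport_mem D W E₀ ψ τ hw hwv hN)

/-! ## §1 Additivity and `Γ_F`-equivariance of the transported periods -/

include hWE hψ in
set_option maxHeartbeats 1600000 in
/-- ★ **ADDITIVITY `Λ^T_{τ+τ'} = Λ^T_τ + Λ^T_{τ'}`.** For `τ, τ' ∈ T_pŴ_D` with transports `w, w'`, the transport `u` of `τ + τ'`, `N ≥ e`, and ANY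
witnesses `z, z', z''`: `Λ_N(ι[ũ], z'') = Λ_N(ι[w̃], z) + Λ_N(ι[w̃'], z')` — `u = w ⊕_{E₀} w'` (`transport_seqO_add`) and the φ-road's additivity on deep
towers (`logSum_divisionLiftPt_addSeq`, depth `‖T(·)₀‖^N ≤ ‖p‖`). [cite: Colmez1992PeriodesAbeliennes, §2] [cite: Katz1981CrystallineDieudonne, Thm. 5.1.5] -/
theorem logSum_transport_add (τ τ' : AinfTop.TatePtO F (W.map ψ) p) {w w' u : ℕ → (maxNilIdealC F).toIdeal}
    (hw : ∀ n, AinfTop.mulPC F p E₀ (w (n + 1)) = w n) (hw' : ∀ n, AinfTop.mulPC F p E₀ (w' (n + 1)) = w' n)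
    (hwv : ∀ n, ‖(((w n : (maxNilIdealC F).toIdeal) : CBall F) : CompletedAlgClosure F) -
      (((AinfTop.seqO (W.map ψ) τ n : (maxNilIdealC F).toIdeal) : CBall F) : CompletedAlgClosure F)‖ ≤ ‖((D.rootC : integerC F) : CompletedAlgClosure F)‖)
    (hw'v : ∀ n, ‖(((w' n : (maxNilIdealC F).toIdeal) : CBall F) : CompletedAlgClosure F) -
      (((AinfTop.seqO (W.map ψ) τ' n : (maxNilIdealC F).toIdeal) : CBall F) : CompletedAlgClosure F)‖ ≤ ‖((D.rootC : integerC F) : CompletedAlgClosure F)‖)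
    (hu : ∀ n, AinfTop.mulPC F p E₀ (u (n + 1)) = u n)
    (huv : ∀ n, ‖(((u n : (maxNilIdealC F).toIdeal) : CBall F) : CompletedAlgClosure F) -
      (((AinfTop.seqO (W.map ψ) (τ + τ') n : (maxNilIdealC F).toIdeal) : CBall F) : CompletedAlgClosure F)‖ ≤ ‖((D.rootC : integerC F) : CompletedAlgClosure F)‖)
    {N : ℕ} (hN : D.e ≤ N) {z z' z'' : bmaxZero F p}
    (hz : algebraMap (Ainf (p := p) F) (bmaxZero F p)
        ((AinfTop.of F p).symm (((AinfTop.divisionLiftPt E₀ hθ w hw).val : (AinfTop.nilTheta F p hθ).toIdeal) : AinfTop F p)) ^ N =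
      (p : bmaxZero F p) * z)
    (hz' : algebraMap (Ainf (p := p) F) (bmaxZero F p)
        ((AinfTop.of F p).symm (((AinfTop.divisionLiftPt E₀ hθ w' hw').val : (AinfTop.nilTheta F p hθ).toIdeal) : AinfTop F p)) ^ N =
      (p : bmaxZero F p) * z')
    (hz'' : algebraMap (Ainf (p := p) F) (bmaxZero F p)
        ((AinfTop.of F p).symm (((AinfTop.divisionLiftPt E₀ hθ u hu).val : (AinfTop.nilTheta F p hθ).toIdeal) : AinfTop F p)) ^ N =
      (p : bmaxZero F p) * z'') :
    PadicLogSeries.logSum ((algebraMap (Ainf (p := p) F) (bmaxZero F p)).comp zpToAinf) (GaloisContinuity.formalLogNum E₀ p) N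
          (algebraMap (Ainf (p := p) F) (bmaxZero F p)
            ((AinfTop.of F p).symm (((AinfTop.divisionLiftPt E₀ hθ u hu).val : (AinfTop.nilTheta F p hθ).toIdeal) : AinfTop F p))) z'' =
      PadicLogSeries.logSum ((algebraMap (Ainf (p := p) F) (bmaxZero F p)).comp zpToAinf) (GaloisContinuity.formalLogNum E₀ p) N
          (algebraMap (Ainf (p := p) F) (bmaxZero F p)
            ((AinfTop.of F p).symm (((AinfTop.divisionLiftPt E₀ hθ w hw).val : (AinfTop.nilTheta F p hθ).toIdeal) : AinfTop F p))) z +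
        PadicLogSeries.logSum ((algebraMap (Ainf (p := p) F) (bmaxZero F p)).comp zpToAinf) (GaloisContinuity.formalLogNum E₀ p) N
          (algebraMap (Ainf (p := p) F) (bmaxZero F p)
            ((AinfTop.of F p).symm (((AinfTop.divisionLiftPt E₀ hθ w' hw').val : (AinfTop.nilTheta F p hθ).toIdeal) : AinfTop F p))) z' := by
  have hN1 : 1 ≤ N := D.e_pos.trans_le hN
  obtain rfl := transport_seqO_add D W E₀ hWE ψ hψ τ τ' hw hw' hwv hw'v hu huv
  exact AinfTop.logSum_divisionLiftPt_addSeq E₀ (hθ := hθ) hw hw' hN1 (norm_transport_seqO_zero_pow_le D W ψ τ hwv hN)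
    (norm_transport_seqO_zero_pow_le D W ψ τ' hw'v hN) hz hz' hz''

set_option maxHeartbeats 1600000 in
/-- ★ **`Γ_F`-EQUIVARIANCE `σ(Λ^T_τ) = Λ^T_{σ•τ}`.** For `τ ∈ T_pŴ_D` with transport `w`, the transport `w'` of `σ • τ`, and ANY witnesses `z, z'`:
`σ(Λ_N(ι[w̃], z)) = Λ_N(ι[w̃'], z')` — `w' = σw` (`transport_seqO_smul`), naturality of the `p`-adic sums (`galBmaxPlus_logSum_divisionLiftPt`) and
independence of the witness. [cite: FontaineAsterisque223III, Exp. II §1.2, §1.5] [cite: Colmez1992PeriodesAbeliennes, §2] -/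
theorem galBmaxPlus_logSum_transport (σ : absoluteGaloisGroup F) (τ : AinfTop.TatePtO F (W.map ψ) p) {w w' : ℕ → (maxNilIdealC F).toIdeal}
    (hw : ∀ n, AinfTop.mulPC F p E₀ (w (n + 1)) = w n)
    (hwv : ∀ n, ‖(((w n : (maxNilIdealC F).toIdeal) : CBall F) : CompletedAlgClosure F) -
      (((AinfTop.seqO (W.map ψ) τ n : (maxNilIdealC F).toIdeal) : CBall F) : CompletedAlgClosure F)‖ ≤ ‖((D.rootC : integerC F) : CompletedAlgClosure F)‖)
    (hw' : ∀ n, AinfTop.mulPC F p E₀ (w' (n + 1)) = w' n)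
    (hw'v : ∀ n, ‖(((w' n : (maxNilIdealC F).toIdeal) : CBall F) : CompletedAlgClosure F) -
      (((AinfTop.seqO (W.map ψ) (σ • τ) n : (maxNilIdealC F).toIdeal) : CBall F) : CompletedAlgClosure F)‖ ≤ ‖((D.rootC : integerC F) : CompletedAlgClosure F)‖)
    {N : ℕ} {z z' : bmaxZero F p}
    (hz : algebraMap (Ainf (p := p) F) (bmaxZero F p)
        ((AinfTop.of F p).symm (((AinfTop.divisionLiftPt E₀ hθ w hw).val : (AinfTop.nilTheta F p hθ).toIdeal) : AinfTop F p)) ^ N =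
      (p : bmaxZero F p) * z)
    (hz' : algebraMap (Ainf (p := p) F) (bmaxZero F p)
        ((AinfTop.of F p).symm (((AinfTop.divisionLiftPt E₀ hθ w' hw').val : (AinfTop.nilTheta F p hθ).toIdeal) : AinfTop F p)) ^ N =
      (p : bmaxZero F p) * z') :
    galBmaxPlus σ (PadicLogSeries.logSum ((algebraMap (Ainf (p := p) F) (bmaxZero F p)).comp zpToAinf) (GaloisContinuity.formalLogNum E₀ p) N
          (algebraMap (Ainf (p := p) F) (bmaxZero F p)
            ((AinfTop.of F p).symm (((AinfTop.divisionLiftPt E₀ hθ w hw).val : (AinfTop.nilTheta F p hθ).toIdeal) : AinfTop F p))) z) =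
      PadicLogSeries.logSum ((algebraMap (Ainf (p := p) F) (bmaxZero F p)).comp zpToAinf) (GaloisContinuity.formalLogNum E₀ p) N
          (algebraMap (Ainf (p := p) F) (bmaxZero F p)
            ((AinfTop.of F p).symm (((AinfTop.divisionLiftPt E₀ hθ w' hw').val : (AinfTop.nilTheta F p hθ).toIdeal) : AinfTop F p))) z' := by
  haveI := isDomain_bmaxZero (F := F) (p := p)
  haveI := charZero_bmaxZero (F := F) (p := p)
  obtain rfl := transport_seqO_smul D W E₀ ψ hθ σ τ hw hwv hw' hw'v
  have h := AinfTop.galBmaxPlus_logSum_divisionLiftPt E₀ (hθ := hθ) (GaloisContinuity.formalLogNum E₀ p) σ hw N z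
  exact h.trans (PadicLogSeries.logSum_congr_witness _ _ (AinfTop.algebraMap_divisionLiftPt_galSeq_pow_eq E₀ hw (hθ := hθ) σ hz) hz')

/-! ## §2 The transported period map as an honest additive map `T_pŴ_D →+ A_max` -/

include hWE hψ in
set_option maxHeartbeats 3200000 in
/-- ★★ **The transported `A_max`-period map `LT : T_pŴ_D(𝒪_{ℂ_F}) →+ A_max`** (`N ≥ e`): there is an additive `LT` with
`LT τ = Λ_N(ι[T(τ)~], z)` for EVERY exact `[p]_{E₀}`-tower `ϖ`-close to `seqO τ` (they all coincide) and EVERY witness `z`; it is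
**`ℤ_p`-linear** (`LT (c • τ) = ι(c)·LT τ`: write `c = r + pⁿd` with `r ∈ ℕ`, `PadicInt.appr`; additivity gives `LT(c•τ) − ι(c)LT τ ∈ pⁿA_max` for
every `n`, and `A_max` is `p`-adically separated, `AinfTop.eq_zero_of_forall_exists_pow_mul`) and **`Γ_F`-equivariant** (`σ(LT τ) = LT(σ • τ)`).
[cite: Colmez1992PeriodesAbeliennes, §2] [cite: FontaineAsterisque223III, Exp. II §1.5] [cite: Katz1981CrystallineDieudonne, Thm. 5.1.5] -/
theorem exists_addMonoidHom_logSum_transport {N : ℕ} (hN : D.e ≤ N) :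
    ∃ LT : AinfTop.TatePtO F (W.map ψ) p →+ BmaxPlus F p,
      (∀ (τ : AinfTop.TatePtO F (W.map ψ) p) (w : ℕ → (maxNilIdealC F).toIdeal) (hw : ∀ n, AinfTop.mulPC F p E₀ (w (n + 1)) = w n)
        (_ : ∀ n, ‖(((w n : (maxNilIdealC F).toIdeal) : CBall F) : CompletedAlgClosure F) -
      (((AinfTop.seqO (W.map ψ) τ n : (maxNilIdealC F).toIdeal) : CBall F) : CompletedAlgClosure F)‖ ≤ ‖((D.rootC : integerC F) : CompletedAlgClosure F)‖)
        (z : bmaxZero F p), algebraMap (Ainf (p := p) F) (bmaxZero F p)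
        ((AinfTop.of F p).symm (((AinfTop.divisionLiftPt E₀ hθ w hw).val : (AinfTop.nilTheta F p hθ).toIdeal) : AinfTop F p)) ^ N =
      (p : bmaxZero F p) * z →
        LT τ = PadicLogSeries.logSum ((algebraMap (Ainf (p := p) F) (bmaxZero F p)).comp zpToAinf) (GaloisContinuity.formalLogNum E₀ p) N
          (algebraMap (Ainf (p := p) F) (bmaxZero F p)
            ((AinfTop.of F p).symm (((AinfTop.divisionLiftPt E₀ hθ w hw).val : (AinfTop.nilTheta F p hθ).toIdeal) : AinfTop F p))) z) ∧
      (∀ (c : ℤ_[p]) (τ : AinfTop.TatePtO F (W.map ψ) p), LT (c • τ) = ainfToBmaxPlus F p (zpToAinf c) * LT τ) ∧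
      (∀ (σ : absoluteGaloisGroup F) (τ : AinfTop.TatePtO F (W.map ψ) p), galBmaxPlus σ (LT τ) = LT (σ • τ)) := by
  haveI := isDomain_bmaxZero (F := F) (p := p)
  haveI := charZero_bmaxZero (F := F) (p := p)
  -- choose transports and witnesses
  choose wf hwf hwfv using fun τ : AinfTop.TatePtO F (W.map ψ) p =>
    (exists_unique_transport_seqO D W E₀ hWE ψ hψ τ).exists
  choose zf hzf using fun τ : AinfTop.TatePtO F (W.map ψ) p => exists_witness_transport D W E₀ ψ τ (hwf τ) (hwfv τ) hN (hθ := hθ)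
  refine ⟨AddMonoidHom.mk' (fun τ => PadicLogSeries.logSum ((algebraMap (Ainf (p := p) F) (bmaxZero F p)).comp zpToAinf) (GaloisContinuity.formalLogNum E₀ p) N
          (algebraMap (Ainf (p := p) F) (bmaxZero F p)
            ((AinfTop.of F p).symm (((AinfTop.divisionLiftPt E₀ hθ (wf τ) (hwf τ)).val : (AinfTop.nilTheta F p hθ).toIdeal) : AinfTop F p))) (zf τ))
      (fun τ τ' => logSum_transport_add D W E₀ hWE ψ hψ τ τ' (hwf τ) (hwf τ') (hwfv τ) (hwfv τ') (hwf (τ + τ')) (hwfv (τ + τ')) hN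
        (hzf τ) (hzf τ') (hzf (τ + τ'))), ?_, ?_, ?_⟩
  · -- independence of the transport (uniqueness) and of the witness
    intro τ w hw hwv z hz
    obtain rfl : w = wf τ := (exists_unique_transport_seqO D W E₀ hWE ψ hψ τ).unique ⟨hw, hwv⟩ ⟨hwf τ, hwfv τ⟩
    exact PadicLogSeries.logSum_congr_witness _ _ (hzf τ) hz
  · -- `ℤ_p`-linearity by density
    intro c τ
    set LT : AinfTop.TatePtO F (W.map ψ) p →+ BmaxPlus F p := AddMonoidHom.mk' (fun τ => PadicLogSeries.logSum ((algebraMap (Ainf (p := p) F) (bmaxZero F p)).comp zpToAinf) (GaloisContinuity.formalLogNum E₀ p) N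
          (algebraMap (Ainf (p := p) F) (bmaxZero F p)
            ((AinfTop.of F p).symm (((AinfTop.divisionLiftPt E₀ hθ (wf τ) (hwf τ)).val : (AinfTop.nilTheta F p hθ).toIdeal) : AinfTop F p))) (zf τ))
      (fun τ τ' => logSum_transport_add D W E₀ hWE ψ hψ τ τ' (hwf τ) (hwf τ') (hwfv τ) (hwfv τ') (hwf (τ + τ')) (hwfv (τ + τ')) hN
        (hzf τ) (hzf τ') (hzf (τ + τ'))) with hLT
    rw [← sub_eq_zero]
    refine AinfTop.eq_zero_of_forall_exists_pow_mul fun n => ?_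
    obtain ⟨d, hd⟩ := Ideal.mem_span_singleton'.1 (PadicInt.appr_spec n c)
    obtain ⟨r, hr⟩ : ∃ r : ℕ, c.appr n = r := ⟨_, rfl⟩
    rw [hr] at hd
    have hc : c = (r : ℤ_[p]) + (p : ℤ_[p]) ^ n * d := by rw [mul_comm, hd]; ring
    have hsmul : c • τ = r • τ + p ^ n • (d • τ) := by
      rw [hc, add_smul, Nat.cast_smul_eq_nsmul, mul_smul, ← Nat.cast_pow, Nat.cast_smul_eq_nsmul]
    have hι : ainfToBmaxPlus F p (zpToAinf c) = (r : BmaxPlus F p) + (p : BmaxPlus F p) ^ n * ainfToBmaxPlus F p (zpToAinf d) := by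
      rw [hc, map_add, map_mul, map_pow, map_natCast, map_natCast, map_add, map_mul, map_pow, map_natCast, map_natCast]
    refine ⟨LT (d • τ) - ainfToBmaxPlus F p (zpToAinf d) * LT τ, ?_⟩
    rw [hsmul, map_add, map_nsmul, map_nsmul, hι, nsmul_eq_mul, nsmul_eq_mul, Nat.cast_pow]
    ring
  · -- `Γ_F`-equivariance
    intro σ τ
    exact galBmaxPlus_logSum_transport D W E₀ ψ (hθ := hθ) σ τ (hwf τ) (hwfv τ) (hwf (σ • τ)) (hwfv (σ • τ)) (hzf τ) (hzf (σ • τ))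

/-! ## §3 The Honda relation for the transported periods -/

set_option maxHeartbeats 1600000 in
/-- ★ **The EXACT Dieudonné–Honda relation `φ²(LT τ) − a_p·φ(LT τ) + p·LT τ = 0` in `A_max`** for the transported period map (through its
specification `hLT`), `a_p = HasseManin.tr (E₀ ⊗ 𝔽_p)`, when `E₀ ⊗ ℚ_p` and `E₀ ⊗ 𝔽_p` are elliptic: the φ-road's relation holds for EVERY
`[p]_{E₀}`-division sequence, in particular for the transported towers (whose base points need not vanish). [cite: Honda1970, Thm. 2]
[cite: Colmez1992PeriodesAbeliennes, §2] -/
theorem frobBmaxPlus_hondaTrace_transport_eq_zero [(E₀.map (Int.castRingHom ℚ_[p])).IsElliptic]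
    [(E₀.map (Int.castRingHom (ZMod p))).IsElliptic] {N : ℕ} (hN : D.e ≤ N)
    {LT : AinfTop.TatePtO F (W.map ψ) p →+ BmaxPlus F p}
    (hLT : ∀ (τ : AinfTop.TatePtO F (W.map ψ) p) (w : ℕ → (maxNilIdealC F).toIdeal) (hw : ∀ n, AinfTop.mulPC F p E₀ (w (n + 1)) = w n)
        (_ : ∀ n, ‖(((w n : (maxNilIdealC F).toIdeal) : CBall F) : CompletedAlgClosure F) -
      (((AinfTop.seqO (W.map ψ) τ n : (maxNilIdealC F).toIdeal) : CBall F) : CompletedAlgClosure F)‖ ≤ ‖((D.rootC : integerC F) : CompletedAlgClosure F)‖)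
        (z : bmaxZero F p), algebraMap (Ainf (p := p) F) (bmaxZero F p)
        ((AinfTop.of F p).symm (((AinfTop.divisionLiftPt E₀ hθ w hw).val : (AinfTop.nilTheta F p hθ).toIdeal) : AinfTop F p)) ^ N =
      (p : bmaxZero F p) * z →
        LT τ = PadicLogSeries.logSum ((algebraMap (Ainf (p := p) F) (bmaxZero F p)).comp zpToAinf) (GaloisContinuity.formalLogNum E₀ p) N
          (algebraMap (Ainf (p := p) F) (bmaxZero F p)
            ((AinfTop.of F p).symm (((AinfTop.divisionLiftPt E₀ hθ w hw).val : (AinfTop.nilTheta F p hθ).toIdeal) : AinfTop F p))) z)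
    (τ : AinfTop.TatePtO F (W.map ψ) p) {w : ℕ → (maxNilIdealC F).toIdeal} (hw : ∀ n, AinfTop.mulPC F p E₀ (w (n + 1)) = w n)
    (hwv : ∀ n, ‖(((w n : (maxNilIdealC F).toIdeal) : CBall F) : CompletedAlgClosure F) -
      (((AinfTop.seqO (W.map ψ) τ n : (maxNilIdealC F).toIdeal) : CBall F) : CompletedAlgClosure F)‖ ≤ ‖((D.rootC : integerC F) : CompletedAlgClosure F)‖) :
    frobBmaxPlus F p (frobBmaxPlus F p (LT τ)) -
        AdicCompletion.of (Ideal.span {(p : bmaxZero F p)}) (bmaxZero F p)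
          (((algebraMap (Ainf (p := p) F) (bmaxZero F p)).comp zpToAinf)
            ((HasseManin.tr (E₀.map (Int.castRingHom (ZMod p))) : ℤ) : ℤ_[p])) * frobBmaxPlus F p (LT τ) +
      AdicCompletion.of (Ideal.span {(p : bmaxZero F p)}) (bmaxZero F p) (p : bmaxZero F p) * LT τ = 0 := by
  obtain ⟨z, hz⟩ := exists_witness_transport D W E₀ ψ τ hw hwv hN (hθ := hθ)
  rw [hLT τ w hw hwv z hz]
  exact AinfTop.frobBmaxPlus_hondaTrace_logSum_divisionLiftPt_eq_zero E₀ (hθ := hθ) hw (D.e_pos.trans_le hN) hz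

/-! ## §4 The Kummer integrating identity `LT(κ_u σ) = σΛ_{Tu} − Λ_{Tu}` -/

omit [Fact (¬ IsUnit (p : integerC F))] [IsAdicComplete (Ideal.span {(p : integerC F)}) (integerC F)] in
/-- **Depth of the transport of a deep tower**: if `‖u₀‖^N ≤ ‖p‖` and `N ≥ e` then `‖(Tu)₀‖^N ≤ ‖p‖` (`‖(Tu)₀ − u₀‖ ≤ ‖ϖ‖`, ultrametric).
[cite: Colmez1992PeriodesAbeliennes, §2] -/
theorem norm_transport_zero_pow_le_of_norm_pow_le {u Tu : ℕ → (maxNilIdealC F).toIdeal}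
    (hTuv : ∀ n, ‖(((Tu n : (maxNilIdealC F).toIdeal) : CBall F) : CompletedAlgClosure F) -
      (((u n : (maxNilIdealC F).toIdeal) : CBall F) : CompletedAlgClosure F)‖ ≤ ‖((D.rootC : integerC F) : CompletedAlgClosure F)‖)
    {N : ℕ} (hN : D.e ≤ N)
    (huN : ‖(((u 0 : (maxNilIdealC F).toIdeal) : CBall F) : CompletedAlgClosure F)‖ ^ N ≤ ‖(p : CompletedAlgClosure F)‖) :
    ‖(((Tu 0 : (maxNilIdealC F).toIdeal) : CBall F) : CompletedAlgClosure F)‖ ^ N ≤ ‖(p : CompletedAlgClosure F)‖ := by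
  have hsplit : (((Tu 0 : (maxNilIdealC F).toIdeal) : CBall F) : CompletedAlgClosure F) =
      ((((Tu 0 : (maxNilIdealC F).toIdeal) : CBall F) : CompletedAlgClosure F) - (((u 0 : (maxNilIdealC F).toIdeal) : CBall F) : CompletedAlgClosure F)) +
        (((u 0 : (maxNilIdealC F).toIdeal) : CBall F) : CompletedAlgClosure F) := by ring
  rcases le_total ‖((((Tu 0 : (maxNilIdealC F).toIdeal) : CBall F) : CompletedAlgClosure F) -
      (((u 0 : (maxNilIdealC F).toIdeal) : CBall F) : CompletedAlgClosure F))‖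
      ‖(((u 0 : (maxNilIdealC F).toIdeal) : CBall F) : CompletedAlgClosure F)‖ with h | h
  · have hle : ‖(((Tu 0 : (maxNilIdealC F).toIdeal) : CBall F) : CompletedAlgClosure F)‖ ≤
        ‖(((u 0 : (maxNilIdealC F).toIdeal) : CBall F) : CompletedAlgClosure F)‖ := by
      rw [hsplit]; exact (IsUltrametricDist.norm_add_le_max _ _).trans (max_le h le_rfl)
    exact (pow_le_pow_left₀ (norm_nonneg _) hle N).trans huN
  · have hle : ‖(((Tu 0 : (maxNilIdealC F).toIdeal) : CBall F) : CompletedAlgClosure F)‖ ≤ ‖((D.rootC : integerC F) : CompletedAlgClosure F)‖ := by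
      rw [hsplit]; exact (IsUltrametricDist.norm_add_le_max _ _).trans (max_le (hTuv 0) (h.trans (hTuv 0)))
    calc ‖(((Tu 0 : (maxNilIdealC F).toIdeal) : CBall F) : CompletedAlgClosure F)‖ ^ N
        ≤ ‖((D.rootC : integerC F) : CompletedAlgClosure F)‖ ^ N := pow_le_pow_left₀ (norm_nonneg _) hle N
      _ ≤ ‖((D.rootC : integerC F) : CompletedAlgClosure F)‖ ^ D.e :=
          pow_le_pow_of_le_one (norm_nonneg _) D.norm_rootC_lt_one.le hN
      _ = ‖(p : CompletedAlgClosure F)‖ := D.norm_rootC_pow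

include hWE in
set_option maxHeartbeats 3200000 in
/-- ★★ **The Kummer integrating identity `LT(κ_u σ) = σ(Λ_{Tu}) − Λ_{Tu}` in `A_max`.** Let `u` be a `[p]_{W_D}`-division tower of points of
`Ŵ_D(𝔪_{ℂ_F})` with `Γ_F`-fixed base point `u₀` (an `F`-rational point) and `‖u₀‖^N ≤ ‖p‖`, `N ≥ e`; `Tu` its transport, `Λ_{Tu} = Λ_N(ι[Tu~], z)`
(any witness). Then the Kummer cocycle `κ_u(σ) ∈ T_pŴ_D` (`AinfRamTop.kummerCocycleO`, coordinate sequence `σu ⊖_{W_D} u`) has transported period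
`LT(κ_u σ) = σ(Λ_{Tu}) − Λ_{Tu}`: `T(κ_u σ) ⊕_{E₀} Tu = σ·Tu` (`addSeq_transport_kummer_eq_galSeq`), additivity of `Λ_N` on deep towers, and
`Λ_N(ι[σTu~], σz) = σΛ_N(ι[Tu~], z)`. [cite: BlochKato1990, Ex. 3.10.1] [cite: FontaineAsterisque223III, Exp. II §1.2.2] [cite: Katz1981CrystallineDieudonne, Thm. 5.1.5] -/
theorem logSum_transport_kummerCocycleO {N : ℕ} (hN : D.e ≤ N)
    {LT : AinfTop.TatePtO F (W.map ψ) p →+ BmaxPlus F p}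
    (hLT : ∀ (τ : AinfTop.TatePtO F (W.map ψ) p) (w : ℕ → (maxNilIdealC F).toIdeal) (hw : ∀ n, AinfTop.mulPC F p E₀ (w (n + 1)) = w n)
        (_ : ∀ n, ‖(((w n : (maxNilIdealC F).toIdeal) : CBall F) : CompletedAlgClosure F) -
      (((AinfTop.seqO (W.map ψ) τ n : (maxNilIdealC F).toIdeal) : CBall F) : CompletedAlgClosure F)‖ ≤ ‖((D.rootC : integerC F) : CompletedAlgClosure F)‖)
        (z : bmaxZero F p), algebraMap (Ainf (p := p) F) (bmaxZero F p)
        ((AinfTop.of F p).symm (((AinfTop.divisionLiftPt E₀ hθ w hw).val : (AinfTop.nilTheta F p hθ).toIdeal) : AinfTop F p)) ^ N =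
      (p : bmaxZero F p) * z →
        LT τ = PadicLogSeries.logSum ((algebraMap (Ainf (p := p) F) (bmaxZero F p)).comp zpToAinf) (GaloisContinuity.formalLogNum E₀ p) N
          (algebraMap (Ainf (p := p) F) (bmaxZero F p)
            ((AinfTop.of F p).symm (((AinfTop.divisionLiftPt E₀ hθ w hw).val : (AinfTop.nilTheta F p hθ).toIdeal) : AinfTop F p))) z)
    {u : ℕ → (maxNilIdealC F).toIdeal} (hup : ∀ n, AinfRamTop.mulPC W (u (n + 1)) = u n)
    (hu₀ : ∀ σ : absoluteGaloisGroup F, galCBall σ (u 0 : CBall F) = u 0)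
    (huN : ‖(((u 0 : (maxNilIdealC F).toIdeal) : CBall F) : CompletedAlgClosure F)‖ ^ N ≤ ‖(p : CompletedAlgClosure F)‖)
    {Tu : ℕ → (maxNilIdealC F).toIdeal} (hTu : ∀ n, AinfTop.mulPC F p E₀ (Tu (n + 1)) = Tu n)
    (hTuv : ∀ n, ‖(((Tu n : (maxNilIdealC F).toIdeal) : CBall F) : CompletedAlgClosure F) -
      (((u n : (maxNilIdealC F).toIdeal) : CBall F) : CompletedAlgClosure F)‖ ≤ ‖((D.rootC : integerC F) : CompletedAlgClosure F)‖)
    {z : bmaxZero F p} (hz : algebraMap (Ainf (p := p) F) (bmaxZero F p)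
        ((AinfTop.of F p).symm (((AinfTop.divisionLiftPt E₀ hθ Tu hTu).val : (AinfTop.nilTheta F p hθ).toIdeal) : AinfTop F p)) ^ N =
      (p : bmaxZero F p) * z) (σ : absoluteGaloisGroup F) :
    LT (AinfRamTop.kummerCocycleO W ψ hψ u hup hu₀ σ) =
      galBmaxPlus σ (PadicLogSeries.logSum ((algebraMap (Ainf (p := p) F) (bmaxZero F p)).comp zpToAinf) (GaloisContinuity.formalLogNum E₀ p) N
          (algebraMap (Ainf (p := p) F) (bmaxZero F p)
            ((AinfTop.of F p).symm (((AinfTop.divisionLiftPt E₀ hθ Tu hTu).val : (AinfTop.nilTheta F p hθ).toIdeal) : AinfTop F p))) z) -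
        PadicLogSeries.logSum ((algebraMap (Ainf (p := p) F) (bmaxZero F p)).comp zpToAinf) (GaloisContinuity.formalLogNum E₀ p) N
          (algebraMap (Ainf (p := p) F) (bmaxZero F p)
            ((AinfTop.of F p).symm (((AinfTop.divisionLiftPt E₀ hθ Tu hTu).val : (AinfTop.nilTheta F p hθ).toIdeal) : AinfTop F p))) z := by
  haveI := isDomain_bmaxZero (F := F) (p := p)
  haveI := charZero_bmaxZero (F := F) (p := p)
  have hN1 : 1 ≤ N := D.e_pos.trans_le hN
  -- the transport `Tκ` of the Kummer tower and its witness
  obtain ⟨Tκ, ⟨hTκ, hTκv⟩, -⟩ := exists_unique_transport_seqO D W E₀ hWE ψ hψ (AinfRamTop.kummerCocycleO W ψ hψ u hup hu₀ σ)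
  obtain ⟨zκ, hzκ⟩ := exists_witness_transport D W E₀ ψ _ hTκ hTκv hN (hθ := hθ)
  rw [hLT _ Tκ hTκ hTκv zκ hzκ]
  -- `Tκ ⊕ Tu = σ·Tu`
  have hTκv' : ∀ n, ‖(((Tκ n : (maxNilIdealC F).toIdeal) : CBall F) : CompletedAlgClosure F) -
      (((AinfRamTop.kummerSeqO W ψ σ u n : (maxNilIdealC F).toIdeal) : CBall F) : CompletedAlgClosure F)‖ ≤ ‖((D.rootC : integerC F) : CompletedAlgClosure F)‖ := by
    simpa only [AinfRamTop.seqO_kummerCocycleO] using hTκv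
  have hsum := addSeq_transport_kummer_eq_galSeq D W E₀ hWE ψ hψ hθ σ hTu hTuv hTκ hTκv'
  have hpt : AinfTop.divisionLiftPt E₀ hθ (AinfTop.addSeq F E₀ Tκ Tu) (AinfTop.mulPC_addSeq E₀ hTκ hTu) =
      AinfTop.divisionLiftPt E₀ hθ (AinfTop.galSeq F σ Tu) (AinfTop.mulPC_galSeq E₀ hθ σ hTu) := AinfTop.divisionLiftPt_congr E₀ hsum _ _
  -- witness for the sum: `σ z`
  have hzσ := AinfTop.algebraMap_divisionLiftPt_galSeq_pow_eq E₀ hTu (hθ := hθ) σ hz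
  rw [← hpt] at hzσ
  -- depth of `Tκ` and `Tu`
  have hdκ := norm_transport_seqO_zero_pow_le D W ψ _ hTκv hN
  have hdu := norm_transport_zero_pow_le_of_norm_pow_le D hTuv hN huN
  have hadd := AinfTop.logSum_divisionLiftPt_addSeq E₀ (hθ := hθ) hTκ hTu hN1 hdκ hdu hzκ hz hzσ
  have hgal := AinfTop.galBmaxPlus_logSum_divisionLiftPt E₀ (hθ := hθ) (GaloisContinuity.formalLogNum E₀ p) σ hTu N z
  -- `Λ(sum, σz) = Λ(σTu, σz) = σΛ(Tu, z)`
  have hsum' : PadicLogSeries.logSum ((algebraMap (Ainf (p := p) F) (bmaxZero F p)).comp zpToAinf) (GaloisContinuity.formalLogNum E₀ p) N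
          (algebraMap (Ainf (p := p) F) (bmaxZero F p)
            ((AinfTop.of F p).symm (((AinfTop.divisionLiftPt E₀ hθ (AinfTop.addSeq F E₀ Tκ Tu) (AinfTop.mulPC_addSeq E₀ hTκ hTu)).val : (AinfTop.nilTheta F p hθ).toIdeal) : AinfTop F p))) (galBmaxZero σ z) =
      PadicLogSeries.logSum ((algebraMap (Ainf (p := p) F) (bmaxZero F p)).comp zpToAinf) (GaloisContinuity.formalLogNum E₀ p) N
          (algebraMap (Ainf (p := p) F) (bmaxZero F p)
            ((AinfTop.of F p).symm (((AinfTop.divisionLiftPt E₀ hθ (AinfTop.galSeq F σ Tu) (AinfTop.mulPC_galSeq E₀ hθ σ hTu)).val : (AinfTop.nilTheta F p hθ).toIdeal) : AinfTop F p))) (galBmaxZero σ z) := by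
    rw [hpt]
  rw [hsum', ← hgal] at hadd
  linear_combination -hadd

end Literature.NumberTheory.PAdicHodge
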